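import Literature.AnabelianGeometry.EtaleTheta.SettingModelSlice2Cusps
import HarnessLib

/-!
# (L3′) slice 2, file 10/13 — the discrete shadow `U_d = η⁻¹(Û_l)`, fixed words, the transversal induction; parallel cusps `ξ, ξ′` and the letters `u_{x,s}` are fixed (S8′)

Part of the (L3′) slice-2 chain (abc-iut-L6-t19; FILING SHAPE derived from scratch v5 `Slice2TheoremR2ScratchV5.lean`
551b982286441a66 by the edits E1–E4/D1–D3/H1–H2 of FILING-PLAN-SLICE2.md 9643c7e42a42ad24 and the OPTION-L re-cut of §F v1.19gz (W):
one definitions file + twelve theorem files).  Classical profinite group theory about OUR semi-synthetic `F₂hatT`; the objects and laws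
are those of the one-sentence residual of record (cf. [EtTh] §1, §2 for the role they play there — nothing of [EtTh]/[IUTchII]/[IUTchIII]
in print is asserted; no side on [IUTchIII] Cor. 3.12; MORATORIUM (E): no application to `hext_at_iff_exists_f2hatAut_of_eq`).
-/

noncomputable section

open scoped Pointwise

namespace Literature.AnabelianGeometry.EtaleTheta.SettingModel.Slice2

open Literature.AnabelianGeometry.EtaleTheta.SettingModel
open Literature.AnabelianGeometry.EtaleTheta (ZHatLevel.level ZHatLevel.levelChar)
open Literature.AnabelianGeometry.SemiGraphs (GQp)
open Literature.AnabelianGeometry.AbsoluteAnabelian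
open Literature.AnabelianGeometry.AbsoluteAnabelian.AbsTopII
open _root_.Topology

/-! ## §16 (S10 of PL3-R2, KERNEL ROUTE) GENERATION BY A SCHREIER TRANSVERSAL OF `Û ∩ F₂` IN `F₂`

Instead of the Bass–Serre structure theorem: the discrete subgroup `U_d := {g ∈ F₂ : η g ∈ Û_l}` (index `l²`)
has the Schreier transversal `T = {a^x b^i : 1 ≤ x ≤ l−1, 0 ≤ i < l} ∪ {β_{−1}^j : 0 ≤ j < l}`, all of whose
Schreier generators `t s · rep(ts)⁻¹` are: axis cusps `κ_x^{±1}`, `A^{±1}`, `V_{−1}`-cusps, `t_k^{±1}`, and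
TWO-SYLLABLE elements `β_x^{i} β_{x±1}^{−i'}` (here `l` PRIME is used: `x ± 1` must be units mod `l`).  All of
these are `Ψ′`-fixed, so `Ψ′ ∘ η = η` on `U_d` by the transversal induction, and `Ψ′ = id` on `Û_l` by density. -/

section Generation

variable {p : ℕ} [Fact p.Prime] {l : ℕ+} {U₀ : Subgroup (GQp p)} {m : ℕ+} {f' : F₂hatT} {Ψ : F₂hatT → F₂hatT}

/-- [cite: MochizukiEtTh2009, Def 2.5 (i) p.39] -/
theorem mem_Ud_iff (g : F₂) : g ∈ Ud l ↔ eta g ∈ Uhat l := Iff.rfl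

/-- [cite: MochizukiEtTh2009, §1 p.12] -/
theorem Residual.mem_fixedWords_iff (h : Residual p l U₀ m f' Ψ) (g : F₂) :
    g ∈ h.fixedWords ↔ eta g ∈ Uhat l ∧ Ψ (eta g) = eta g := Iff.rfl

/-- Membership in `fixedWords` from an identification `η g = y` with `y ∈ Û_l` fixed. [cite: MochizukiEtTh2009, §1 p.12] -/
theorem Residual.mem_fixedWords_of_eq (h : Residual p l U₀ m f' Ψ) {g : F₂} {y : F₂hatT} (hgy : eta g = y)
    (hyU : y ∈ Uhat l) (hψ : Ψ y = y) : g ∈ h.fixedWords := by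
  rw [Residual.mem_fixedWords_iff, hgy]; exact ⟨hyU, hψ⟩

/-- **THE TRANSVERSAL INDUCTION** (Schreier's lemma, existence half, for `F₂`): if `T ∋ 1` and for every
`t ∈ T` and every letter `s ∈ {a^{±1}, b^{±1}}` there is `t' ∈ T` with `t s t'⁻¹ ∈ N`, then every word `g`
satisfies `t₁ g t⁻¹ ∈ N` for some `t ∈ T`, for every `t₁ ∈ T`. [cite: MochizukiEtTh2009, §1 p.12] -/
theorem transversal_induction (N : Subgroup F₂) (T : Set F₂)
    (hstep : ∀ t ∈ T, ∀ s : F₂, (s = FreeGroup.of 0 ∨ s = FreeGroup.of 1 ∨ s = (FreeGroup.of 0)⁻¹ ∨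
      s = (FreeGroup.of 1)⁻¹) → ∃ t' ∈ T, t * s * t'⁻¹ ∈ N)
    (g : F₂) : ∀ t₁ ∈ T, ∃ t ∈ T, t₁ * g * t⁻¹ ∈ N := by
  refine FreeGroup.induction_on g ?_ ?_ ?_ ?_
  · intro t₁ ht₁; exact ⟨t₁, ht₁, by rw [mul_one, mul_inv_cancel]; exact one_mem _⟩
  · intro x t₁ ht₁
    fin_cases x
    · exact hstep t₁ ht₁ _ (Or.inl rfl)
    · exact hstep t₁ ht₁ _ (Or.inr (Or.inl rfl))
  · intro x _ t₁ ht₁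
    fin_cases x
    · exact hstep t₁ ht₁ _ (Or.inr (Or.inr (Or.inl rfl)))
    · exact hstep t₁ ht₁ _ (Or.inr (Or.inr (Or.inr rfl)))
  · intro g₁ g₂ ih₁ ih₂ t₁ ht₁
    obtain ⟨t₂, ht₂, h₁⟩ := ih₁ t₁ ht₁
    obtain ⟨t₃, ht₃, h₂⟩ := ih₂ t₂ ht₂
    refine ⟨t₃, ht₃, ?_⟩
    have := mul_mem h₁ h₂
    rwa [show t₁ * g₁ * t₂⁻¹ * (t₂ * g₂ * t₃⁻¹) = t₁ * (g₁ * g₂) * t₃⁻¹ by group] at this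

/-- **Corollary**: under the same hypotheses, if `1 ∈ T`, `N ≤ H` and `T ∩ H = {1}`, then `H ≤ N`.
[cite: MochizukiEtTh2009, §1 p.12] -/
theorem le_of_transversal (N H : Subgroup F₂) (T : Set F₂) (h1 : (1 : F₂) ∈ T)
    (hstep : ∀ t ∈ T, ∀ s : F₂, (s = FreeGroup.of 0 ∨ s = FreeGroup.of 1 ∨ s = (FreeGroup.of 0)⁻¹ ∨
      s = (FreeGroup.of 1)⁻¹) → ∃ t' ∈ T, t * s * t'⁻¹ ∈ N)
    (hNH : N ≤ H) (hT : ∀ t ∈ T, t ∈ H → t = 1) : H ≤ N := by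
  intro g hg
  obtain ⟨t, ht, hgt⟩ := transversal_induction N T hstep g 1 h1
  rw [one_mul] at hgt
  have htH : t ∈ H := by
    have : g⁻¹ * (g * t⁻¹) ∈ H := mul_mem (inv_mem hg) (hNH hgt)
    rw [inv_mul_cancel_left] at this
    exact inv_mem_iff.mp this
  rw [hT t ht htH, inv_one, mul_one] at hgt
  exact hgt

/-! ### Dictionary: words and their `η`-images -/

/-- Levels of integers: `(η n)_l = n mod l`. [cite: RibesZalesskii2010, Thm 2.7.1] -/
theorem toAdd_level_eta (l : ℕ+) (n : ℤ) : Multiplicative.toAdd (ZHatLevel.level l (ZHatLevel.eta n)) = (n : ZMod l) := by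
  rw [ZHatLevel.level_eta, toAdd_ofAdd]

/-- `β_{s₁}^{t₁} β_{s₂}^{t₂} ∈ Û_l ↔ s̄₁ t̄₁ + s̄₂ t̄₂ = 0`. [cite: MochizukiEtTh2009, Def 2.5 (i) p.39] -/
theorem betaPow_mul_betaPow_mem_Uhat_iff (s₁ t₁ s₂ t₂ : ZH) :
    betaPow s₁ t₁ * betaPow s₂ t₂ ∈ Uhat l ↔
      Multiplicative.toAdd (ZHatLevel.level l s₁) * Multiplicative.toAdd (ZHatLevel.level l t₁) +
        Multiplicative.toAdd (ZHatLevel.level l s₂) * Multiplicative.toAdd (ZHatLevel.level l t₂) = 0 := by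
  rw [mem_Uhat_iff, map_mul, hHat_betaPow, hHat_betaPow]
  simp

/-- `β_{η j}^{η n} = a^j b^n a^{-j}` as a word in `a = η x₀`, `b = η x₁`. [cite: MochizukiEtTh2009, §1 p.12] -/
theorem betaPow_eta_eta (j n : ℤ) : betaPow (ZHatLevel.eta j) (ZHatLevel.eta n) =
    eta (FreeGroup.of 0) ^ j * eta (FreeGroup.of 1) ^ n * eta (FreeGroup.of 0) ^ (-j) := by
  rw [betaPow, aPow_eta, bPow_eta, zpow_neg]

/-- `a^{η n} = a^n`. [cite: MochizukiEtTh2009, §1 p.12] -/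
theorem aPow_eta' (n : ℤ) : aPow (ZHatLevel.eta n) = eta (FreeGroup.of 0) ^ n := aPow_eta n

end Generation

/-! ## §14′ (S8′ of PL3-R2, composite `l`) PARALLEL CUSPS AND THE LETTERS `u_{x,s}` ARE FIXED -/

section Parallel

variable {p : ℕ} [Fact p.Prime] {l : ℕ+} {U₀ : Subgroup (GQp p)} {m : ℕ+} {f' : F₂hatT} {Ψ : F₂hatT → F₂hatT}

/-- `ξ^{(v)} ξ^{(v')} = ξ^{(v v')}`. [cite: MochizukiEtTh2009, §1 p.12] -/
theorem xiC_mul (x : ℤ) (s v v' : ZH) : xiC x s v * xiC x s v' = xiC x s (v * v') := by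
  simp only [xiC, betaPow_mul]; group

/-- `ξ′^{(v)} ξ′^{(v')} = ξ′^{(v v')}`. [cite: MochizukiEtTh2009, §1 p.12] -/
theorem xiC'_mul (x : ℤ) (s v v' : ZH) : xiC' x s v * xiC' x s v' = xiC' x s (v * v') := by
  simp only [xiC', betaPow_mul]; group

/-- `(ξ^{(v)})^n = ξ^{(v^n)}`. [cite: MochizukiEtTh2009, §1 p.12] -/
theorem xiC_pow (x : ℤ) (s v : ZH) (n : ℕ) : xiC x s v ^ n = xiC x s (v ^ n) := by
  induction n with
  | zero => simp [xiC]
  | succ n ih => rw [pow_succ, ih, xiC_mul, pow_succ]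

/-- `(ξ′^{(v)})^n = ξ′^{(v^n)}`. [cite: MochizukiEtTh2009, §1 p.12] -/
theorem xiC'_pow (x : ℤ) (s v : ZH) (n : ℕ) : xiC' x s v ^ n = xiC' x s (v ^ n) := by
  induction n with
  | zero => simp [xiC']
  | succ n ih => rw [pow_succ, ih, xiC'_mul, pow_succ]

/-- `v ↦ ξ^{(v)}` is injective. [cite: MochizukiEtTh2009, §1 p.12] -/
theorem xiC_right_injective (x : ℤ) (s : ZH) {v v' : ZH} (h : xiC x s v = xiC x s v') : v = v' := by
  simp only [xiC] at h; exact betaPow_right_injective _ (mul_left_cancel (mul_right_cancel h))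

/-- `v ↦ ξ′^{(v)}` is injective. [cite: MochizukiEtTh2009, §1 p.12] -/
theorem xiC'_right_injective (x : ℤ) (s : ZH) {v v' : ZH} (h : xiC' x s v = xiC' x s v') : v = v' := by
  simp only [xiC'] at h; exact betaPow_right_injective _ (mul_left_cancel (mul_right_cancel h))

/-- **HNN relation for the parallel edge**: `ξ^{(v)} = u · ξ′^{(v)} · u⁻¹` ([J1]). [cite: MochizukiEtTh2009, §1 p.12] -/
theorem xiC_eq_conj_xiC' (x : ℤ) (s v : ZH) : xiC x s v = uElt x s * xiC' x s v * (uElt x s)⁻¹ := by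
  simp only [xiC, xiC', uElt, betaPow_inv]
  have c1 := betaPow_comm (ZHatLevel.eta x) (s⁻¹ * s⁻¹) v
  calc betaPow (ZHatLevel.eta (x - 1)) s * betaPow (ZHatLevel.eta x) v * (betaPow (ZHatLevel.eta (x - 1)) s)⁻¹
      = betaPow (ZHatLevel.eta (x - 1)) s * (betaPow (ZHatLevel.eta x) (s⁻¹ * s⁻¹) * betaPow (ZHatLevel.eta x) v *
          (betaPow (ZHatLevel.eta x) (s⁻¹ * s⁻¹))⁻¹) * (betaPow (ZHatLevel.eta (x - 1)) s)⁻¹ := by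
        rw [c1, mul_inv_cancel_right]
    _ = _ := by group

/-- `u_{x,s} ∈ Û_l` (levels `(0, 0, s(x−1) − 2sx + s(x+1) = 0)`). [cite: MochizukiEtTh2009, Def 2.5 (i) p.39] -/
theorem uElt_mem_Uhat (x : ℤ) (s : ZH) : uElt x s ∈ Uhat l := by
  rw [uElt, mem_Uhat_iff, map_mul, map_mul, hHat_betaPow, hHat_betaPow, hHat_betaPow]
  refine ⟨by simp, ?_⟩
  simp only [Heis.mul_z, Heis.mul_x, zero_mul, add_zero, map_mul, map_inv, toAdd_mul, toAdd_inv,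
    toAdd_level_eta]
  push_cast; ring

/-- `ξ^{(v)} ∈ Û_l` if `β_x^v ∈ Û_l`. [cite: MochizukiEtTh2009, Def 2.5 (i) p.39] -/
theorem xiC_mem_Uhat {x : ℤ} {s v : ZH} (hv : betaPow (ZHatLevel.eta x) v ∈ Uhat l) : xiC x s v ∈ Uhat l := by
  rw [xiC, conj_mem_Uhat_iff_of_x_eq_zero (by rw [hHat_betaPow])]; exact hv

/-- `ξ′^{(v)} ∈ Û_l` if `β_x^v ∈ Û_l`. [cite: MochizukiEtTh2009, Def 2.5 (i) p.39] -/
theorem xiC'_mem_Uhat {x : ℤ} {s v : ZH} (hv : betaPow (ZHatLevel.eta x) v ∈ Uhat l) : xiC' x s v ∈ Uhat l := by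
  rw [xiC', conj_mem_Uhat_iff_of_x_eq_zero (by rw [hHat_betaPow])]; exact hv

/-- `β_s^{t·t} ∈ Û_l` for `t ∈ mẐ`. [cite: MochizukiEtTh2009, Def 2.5 (i) p.39] -/
theorem betaPow_sq_mem_Uhat (hlm : (l : ℕ) ∣ m) (s c : ZH) :
    betaPow s (c ^ (m : ℕ) * c ^ (m : ℕ)) ∈ Uhat l :=
  betaPow_mem_Uhat_of_level_eq_one _ (by rw [map_mul, level_pow_eq_one_of_dvd hlm, mul_one])

/-- `η(x−1)·η1 = η x`. [cite: RibesZalesskii2010, Thm 2.7.1] -/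
theorem eta_pred_mul (x : ℤ) : ZHatLevel.eta (x - 1) * zOne = ZHatLevel.eta x := by rw [← eta_succ, sub_add_cancel]

/-- `D′_t(β_{x−1}^e) = d_{x−1} β_{x−1}^e d_{x−1}⁻¹`. [cite: MochizukiEtTh2009, Prop 1.5 (iii) p.23] -/
theorem Dp_betaPow_pred (x : ℤ) (t e : ZH) : Dp t (betaPow (ZHatLevel.eta (x - 1)) e) =
    dElt (ZHatLevel.eta (x - 1)) t * betaPow (ZHatLevel.eta (x - 1)) e * (dElt (ZHatLevel.eta (x - 1)) t)⁻¹ :=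
  Dp_eq_conj_of_mem (conj_betaPow_mem_vertGp _ _) t

/-- `D′_t(β_x^e) = d_{x−1} β_x^e d_{x−1}⁻¹` (`β_x ∈ P_{x−1}` too). [cite: MochizukiEtTh2009, Prop 1.5 (iii) p.23] -/
theorem Dp_betaPow_mid (x : ℤ) (t e : ZH) : Dp t (betaPow (ZHatLevel.eta x) e) =
    dElt (ZHatLevel.eta (x - 1)) t * betaPow (ZHatLevel.eta x) e * (dElt (ZHatLevel.eta (x - 1)) t)⁻¹ := by
  have hmem : (aPow (ZHatLevel.eta (x - 1)))⁻¹ * betaPow (ZHatLevel.eta x) e * aPow (ZHatLevel.eta (x - 1)) ∈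
      DehnTwist.vertGp := by
    have := conj_betaPow_succ_mem_vertGp (ZHatLevel.eta (x - 1)) e
    rwa [eta_pred_mul x] at this
  exact Dp_eq_conj_of_mem hmem t

/-- `D′_t(β_{x+1}^e) = d_{x−1} β_x^{t²} β_{x+1}^e β_x^{-t²} d_{x−1}⁻¹` (`d_x = d_{x−1} β_x^{t²}`).
[cite: MochizukiEtTh2009, Prop 1.5 (iii) p.23] -/
theorem Dp_betaPow_succ' (x : ℤ) (t e : ZH) : Dp t (betaPow (ZHatLevel.eta (x + 1)) e) =
    dElt (ZHatLevel.eta (x - 1)) t * (betaPow (ZHatLevel.eta x) (t * t) * betaPow (ZHatLevel.eta (x + 1)) e *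
      (betaPow (ZHatLevel.eta x) (t * t))⁻¹) * (dElt (ZHatLevel.eta (x - 1)) t)⁻¹ := by
  have hmem : (aPow (ZHatLevel.eta x))⁻¹ * betaPow (ZHatLevel.eta (x + 1)) e * aPow (ZHatLevel.eta x) ∈
      DehnTwist.vertGp := by
    have := conj_betaPow_succ_mem_vertGp (ZHatLevel.eta x) e
    rwa [← eta_succ x] at this
  have hd : dElt (ZHatLevel.eta x) t = dElt (ZHatLevel.eta (x - 1)) t * betaPow (ZHatLevel.eta x) (t * t) := by
    have := dElt_succ (ZHatLevel.eta (x - 1)) t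
    rwa [eta_pred_mul x] at this
  rw [Dp_eq_conj_of_mem hmem t, hd]; group

/-- `θ_σ(u_{x,s}) = β_{x−1}^{χs·s⁻¹} · u_{x,s} · ξ′^{(s²·χ(s⁻²))} · β_{x+1}^{s⁻¹·χs}`. [cite: MochizukiEtTh2009, §1 p.12] -/
theorem twist_uElt (σ : GQp p) (x : ℤ) (s : ZH) : twist (chi p σ) (uElt x s) =
    betaPow (ZHatLevel.eta (x - 1)) (chi p σ s * s⁻¹) * uElt x s * xiC' x s (s * s * chi p σ (s⁻¹ * s⁻¹)) *
      betaPow (ZHatLevel.eta (x + 1)) (s⁻¹ * chi p σ s) := by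
  simp only [uElt, xiC', map_mul, map_inv, twist_betaPow, betaPow_mul, betaPow_inv]; group

/-- `θ_σ(ξ^{(e)}) = β_{x−1}^{χs·s⁻¹} ξ^{(χ e)} β_{x−1}^{-(χs·s⁻¹)}`. [cite: MochizukiEtTh2009, §1 p.12] -/
theorem twist_xiC (σ : GQp p) (x : ℤ) (s e : ZH) : twist (chi p σ) (xiC x s e) =
    betaPow (ZHatLevel.eta (x - 1)) (chi p σ s * s⁻¹) * xiC x s (chi p σ e) *
      (betaPow (ZHatLevel.eta (x - 1)) (chi p σ s * s⁻¹))⁻¹ := by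
  simp only [xiC, map_mul, map_inv, twist_betaPow, betaPow_mul, betaPow_inv]; group

/-- **S8′ — PARALLEL CUSPS AND THE LETTER `u_{x,s}` ARE FIXED** (any `x ∈ ℤ`, any `s ∈ Ẑ`):
`Ψ′(ξ^{(v)}) = ξ^{(v)}`, `Ψ′(ξ′^{(v)}) = ξ′^{(v)}` for every `β_x^v ∈ Û_l`, and `Ψ′(u_{x,s}) = u_{x,s}` —
the HNN relation (equal slopes, `Ψ′(u) = ξ^{(w)} u`), the `D′`-law on `u` (slope `1`), the `θ`-law on `u` (`w = 0`).
[cite: MochizukiEtTh2009, §1 p.12] -/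
theorem AxisPinned.psi_parallel (H : AxisPinned p l U₀ m f' Ψ) [U₀.FiniteIndex] (x : ℤ) (s : ZH) :
    (∀ v : ZH, betaPow (ZHatLevel.eta x) v ∈ Uhat l → Ψ (xiC x s v) = xiC x s v) ∧
    (∀ v : ZH, betaPow (ZHatLevel.eta x) v ∈ Uhat l → Ψ (xiC' x s v) = xiC' x s v) ∧ Ψ (uElt x s) = uElt x s := by
  haveI := finiteIndex_U3 p l U₀
  have hx01 : x - 1 ≠ x := by omega
  have hx21 : x + 1 ≠ x := by omega
  -- S8′ (i) at both ends
  have hξ : ∀ v : ZH, bPow v ≠ 1 → betaPow (ZHatLevel.eta x) v ∈ Uhat l → ∃ μ, bPow μ ≠ 1 ∧ Ψ (xiC x s v) = xiC x s μ :=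
    fun v hv hvU => H.psi_parallelCusp (j₀ := x - 1) (i₀ := x - 1) (i₁ := x) hx01
      (Or.inl ⟨rfl, (eta_pred_mul x).symm⟩) s v hv hvU
  have hξ' : ∀ v : ZH, bPow v ≠ 1 → betaPow (ZHatLevel.eta x) v ∈ Uhat l → ∃ μ, bPow μ ≠ 1 ∧ Ψ (xiC' x s v) = xiC' x s μ :=
    fun v hv hvU => H.psi_parallelCusp (j₀ := x) (i₀ := x + 1) (i₁ := x) hx21
      (Or.inr ⟨eta_succ x, rfl⟩) s⁻¹ v hv hvU
  have hUU : uElt x s ∈ Uhat l := uElt_mem_Uhat x s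
  -- (a) HNN: equal slopes, `Ψ′(u) = ξ^{(w)} u`
  have hHNN : ∀ v : ZH, bPow v ≠ 1 → betaPow (ZHatLevel.eta x) v ∈ Uhat l →
      ∃ μ w : ZH, bPow μ ≠ 1 ∧ Ψ (xiC x s v) = xiC x s μ ∧ Ψ (xiC' x s v) = xiC' x s μ ∧ Ψ (uElt x s) = xiC x s w * uElt x s := by
    intro v hv hvU
    obtain ⟨μ, hμ, eξ⟩ := hξ v hv hvU
    obtain ⟨μ', hμ', eξ'⟩ := hξ' v hv hvU
    have e1 : Ψ (xiC x s v) = Ψ (uElt x s) * Ψ (xiC' x s v) * (Ψ (uElt x s))⁻¹ := by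
      rw [xiC_eq_conj_xiC', H.res.mul _ (mul_mem hUU (xiC'_mem_Uhat hvU)) _ (inv_mem hUU),
        H.res.mul _ hUU _ (xiC'_mem_Uhat hvU), H.res.psi_inv hUU]
    rw [eξ, eξ', xiC, xiC'] at e1
    set τ := Ψ (uElt x s) with hτ
    set B1 := betaPow (ZHatLevel.eta (x - 1)) s with hB1
    set B2 := betaPow (ZHatLevel.eta (x + 1)) s⁻¹ with hB2
    rw [betaPow, betaPow] at e1
    set ax := aPow (ZHatLevel.eta x) with hax
    have e2 : ((B1 * ax)⁻¹ * τ * (B2 * ax)) * bPow μ' * ((B1 * ax)⁻¹ * τ * (B2 * ax))⁻¹ = bPow μ := by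
      rw [show bPow μ = (B1 * ax)⁻¹ * (B1 * (ax * bPow μ * ax⁻¹) * B1⁻¹) * (B1 * ax) by group, e1]; group
    obtain ⟨hB, hμμ⟩ := mem_bAxis_and_eq_of_conj_bPow_eq hμ' e2
    obtain ⟨w, hw⟩ := (mem_bAxis_iff _).1 hB
    refine ⟨μ, w * s * s, hμ, eξ, by rw [eξ', ← hμμ], ?_⟩
    have hB2' : betaPow (ZHatLevel.eta (x + 1)) s = B2⁻¹ := by rw [hB2, betaPow_inv, inv_inv]
    have hprod : betaPow (ZHatLevel.eta x) (w * s * s) * betaPow (ZHatLevel.eta x) (s⁻¹ * s⁻¹) = ax * bPow w * ax⁻¹ := by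
      rw [← betaPow_mul, show w * s * s * (s⁻¹ * s⁻¹) = w by group, betaPow]
    calc τ = (B1 * ax) * ((B1 * ax)⁻¹ * τ * (B2 * ax)) * (B2 * ax)⁻¹ := by group
      _ = B1 * (ax * bPow w * ax⁻¹) * B2⁻¹ := by rw [← hw]; group
      _ = B1 * (betaPow (ZHatLevel.eta x) (w * s * s) * betaPow (ZHatLevel.eta x) (s⁻¹ * s⁻¹)) * B2⁻¹ := by rw [hprod]
      _ = xiC x s (w * s * s) * uElt x s := by rw [xiC, uElt, ← hB1, hB2']; group
  -- (b) the `D′`-law on `u`: `Ψ′` fixes `ξ′^{(t²)}` for `t ∈ mẐ`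
  have hfixsq : ∀ c : ZH, Ψ (xiC' x s (c ^ (m : ℕ) * c ^ (m : ℕ))) = xiC' x s (c ^ (m : ℕ) * c ^ (m : ℕ)) := by
    intro c
    set t := c ^ (m : ℕ) with ht
    have htU : betaPow (ZHatLevel.eta x) (t * t) ∈ Uhat l := betaPow_sq_mem_Uhat H.res.dvd _ c
    by_cases h0 : bPow (t * t) = 1
    · have : xiC' x s (t * t) = 1 := by
        rw [xiC', (betaPow_eq_one_iff _ _).2 ((bPow_eq_one_iff _).1 h0), mul_one, mul_inv_cancel]
      rw [this, H.res.psi_one]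
    obtain ⟨μ, w, hμ, -, eξ', eτ⟩ := hHNN _ h0 htU
    set d := dElt (ZHatLevel.eta (x - 1)) t with hd
    have hdU : d ∈ Uhat l := dElt_mem_Uhat (level_pow_eq_one_of_dvd H.res.dvd c)
    have hdfix : Ψ d = d := H.dElt_fixed c (x - 1)
    -- `D′_t(u) = d · u · ξ′^{(t²)} · β_x^{-t²} · d⁻¹`
    have hDu : Dp t (uElt x s) = d * (uElt x s * xiC' x s (t * t) * (betaPow (ZHatLevel.eta x) (t * t))⁻¹) * d⁻¹ := by
      rw [uElt, map_mul, map_mul, Dp_betaPow_pred, Dp_betaPow_mid, Dp_betaPow_succ', ← hd, xiC', betaPow_inv]; group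
    have hDξ : ∀ e : ZH, Dp t (xiC x s e) = d * xiC x s e * d⁻¹ := by
      intro e; rw [xiC, map_mul, map_mul, map_inv, Dp_betaPow_pred, Dp_betaPow_mid, ← hd]; group
    have hβfix : Ψ (betaPow (ZHatLevel.eta x) (t * t)) = betaPow (ZHatLevel.eta x) (t * t) := H.psi_axis x htU
    have hL : Ψ (Dp t (uElt x s)) =
        d * (xiC x s w * uElt x s * xiC' x s μ * (betaPow (ZHatLevel.eta x) (t * t))⁻¹) * d⁻¹ := by
      rw [hDu, H.res.mul _ (mul_mem hdU (mul_mem (mul_mem hUU (xiC'_mem_Uhat htU)) (inv_mem htU))) _ (inv_mem hdU),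
        H.res.mul _ hdU _ (mul_mem (mul_mem hUU (xiC'_mem_Uhat htU)) (inv_mem htU)),
        H.res.mul _ (mul_mem hUU (xiC'_mem_Uhat htU)) _ (inv_mem htU), H.res.mul _ hUU _ (xiC'_mem_Uhat htU),
        H.res.psi_inv hdU, H.res.psi_inv htU, hdfix, hβfix, eτ, eξ']
    have hR : Dp t (Ψ (uElt x s)) =
        d * (xiC x s w * uElt x s * xiC' x s (t * t) * (betaPow (ZHatLevel.eta x) (t * t))⁻¹) * d⁻¹ := by
      rw [eτ, map_mul, hDξ, hDu]; group
    have hDU := H.dexact c (uElt x s) hUU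
    rw [← ht, hL, hR] at hDU
    have e3 : xiC' x s μ = xiC' x s (t * t) :=
      mul_left_cancel (mul_right_cancel (mul_left_cancel (mul_right_cancel hDU)))
    rw [eξ', e3]
  -- (c) slopes are `1`
  have hfix' : ∀ v : ZH, betaPow (ZHatLevel.eta x) v ∈ Uhat l → Ψ (xiC' x s v) = xiC' x s v := by
    intro v hvU
    by_cases hv : bPow v = 1
    · have : xiC' x s v = 1 := by
        rw [xiC', (betaPow_eq_one_iff _ _).2 ((bPow_eq_one_iff _).1 hv), mul_one, mul_inv_cancel]
      rw [this, H.res.psi_one]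
    obtain ⟨μ, hμ, e⟩ := hξ' v hv hvU
    have hsq := hfixsq v
    have hpow : xiC' x s (v ^ (m : ℕ) * v ^ (m : ℕ)) = xiC' x s v ^ (2 * (m : ℕ)) := by
      rw [xiC'_pow, two_mul, pow_add]
    rw [hpow, H.res.psi_pow (xiC'_mem_Uhat hvU), e, xiC'_pow, xiC'_pow] at hsq
    have h5 : μ ^ (2 * (m : ℕ)) = v ^ (2 * (m : ℕ)) := xiC'_right_injective x s hsq
    have h6 : (μ * v⁻¹) ^ (2 * (m : ℕ)) = 1 := by
      rw [(show Commute μ v⁻¹ from ZHatCompletion.mul_comm _ _).mul_pow, inv_pow, h5, mul_inv_cancel]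
    have h7 : μ = v := by
      have := ZHatCompletion.eq_one_of_pow_eq_one (by positivity : 2 * (m : ℕ) ≠ 0) h6
      rwa [mul_inv_eq_one] at this
    rw [e, h7]
  have hfix : ∀ v : ZH, betaPow (ZHatLevel.eta x) v ∈ Uhat l → Ψ (xiC x s v) = xiC x s v := by
    intro v hvU
    by_cases hv : bPow v = 1
    · have : xiC x s v = 1 := by
        rw [xiC, (betaPow_eq_one_iff _ _).2 ((bPow_eq_one_iff _).1 hv), mul_one, mul_inv_cancel]
      rw [this, H.res.psi_one]
    obtain ⟨μ, w, hμ, e1, e2, -⟩ := hHNN v hv hvU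
    have := hfix' v hvU
    rw [e2] at this
    rw [e1, xiC'_right_injective x s this]
  -- (d) `Ψ′(u) = ξ^{(w)} u` with `w` fixed by `χ(U‴)`: `w = 1`
  obtain ⟨μ₁, w, -, -, -, eτ⟩ := hHNN (ZHatLevel.eta (l : ℤ)) (bPow_eta_l_ne_one l) (kappa_mem_Uhat x)
  have hw : w = 1 := by
    refine eq_one_of_forall_chi_apply_eq p (U3 p l U₀) fun σ hσ => ?_
    have hσ0 : σ ∈ U₀ := (Subgroup.mem_inf.mp hσ).1
    have hσl : σ ∈ torusCong p l := (Subgroup.mem_inf.mp hσ).2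
    have hc₁U : betaPow (ZHatLevel.eta (x - 1)) (chi p σ s * s⁻¹) ∈ Uhat l := betaPow_chi_div_mem_Uhat hσl _ _
    have hc₃U : betaPow (ZHatLevel.eta (x + 1)) (s⁻¹ * chi p σ s) ∈ Uhat l := by
      rw [ZHatCompletion.mul_comm]; exact betaPow_chi_div_mem_Uhat hσl _ _
    have he₂U : betaPow (ZHatLevel.eta x) (s * s * chi p σ (s⁻¹ * s⁻¹)) ∈ Uhat l := by
      have : s * s * chi p σ (s⁻¹ * s⁻¹) = chi p σ (s⁻¹ * s⁻¹) * (s⁻¹ * s⁻¹)⁻¹ := by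
        rw [mul_inv_rev, inv_inv, ZHatCompletion.mul_comm]
      rw [this]; exact betaPow_chi_div_mem_Uhat hσl _ _
    have hc₁f := H.psi_axis (x - 1) hc₁U
    have hc₃f := H.psi_axis (x + 1) hc₃U
    have hξ'f := hfix' _ he₂U
    have e1 : Ψ (twist (chi p σ) (uElt x s)) = betaPow (ZHatLevel.eta (x - 1)) (chi p σ s * s⁻¹) *
        (xiC x s w * uElt x s) * xiC' x s (s * s * chi p σ (s⁻¹ * s⁻¹)) *
        betaPow (ZHatLevel.eta (x + 1)) (s⁻¹ * chi p σ s) := by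
      rw [twist_uElt, H.res.mul _ (mul_mem (mul_mem hc₁U hUU) (xiC'_mem_Uhat he₂U)) _ hc₃U,
        H.res.mul _ (mul_mem hc₁U hUU) _ (xiC'_mem_Uhat he₂U), H.res.mul _ hc₁U _ hUU, hc₁f, hc₃f, hξ'f, eτ]
    have e2 : twist (chi p σ) (Ψ (uElt x s)) = betaPow (ZHatLevel.eta (x - 1)) (chi p σ s * s⁻¹) *
        (xiC x s (chi p σ w) * uElt x s) * xiC' x s (s * s * chi p σ (s⁻¹ * s⁻¹)) *
        betaPow (ZHatLevel.eta (x + 1)) (s⁻¹ * chi p σ s) := by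
      rw [eτ, map_mul, twist_xiC, twist_uElt]; group
    rw [H.res.torus σ hσ0 _ hUU] at e1
    rw [e1] at e2
    have e3 : xiC x s w = xiC x s (chi p σ w) :=
      mul_right_cancel (mul_left_cancel (mul_right_cancel (mul_right_cancel e2)))
    exact (xiC_right_injective x s e3).symm
  have hτ : Ψ (uElt x s) = uElt x s := by
    rw [eτ, hw, xiC, betaPow_one, mul_one, mul_inv_cancel, one_mul]
  exact ⟨hfix, hfix', hτ⟩

end Parallel

end Literature.AnabelianGeometry.EtaleTheta.SettingModel.Slice2

end
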